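import Summits.CriticalPhenomena.CardyFormulaZ2.Theses.CardyBoundaryCoulombGas
import Summits.CriticalPhenomena.CardyFormulaZ2.Theorems.CardyBoundaryCoulombGasBoundaryDefectGaussianRStubReferenceLimitPart6
import Summits.CriticalPhenomena.CardyFormulaZ2.Theorems.CardyBoundaryCoulombGasBoundaryDefectGaussianRStubTransferPart5
import HarnessLib

/-!
# Hardness certificate for crux `BoundaryDefectGaussianR` (stmt-CriticalPhenomena-14132), line
# `rainbow-monomials-in-excursion-kernels` — Stub H7: the `(2;2)` member of the crux along the lattice squares

The crux `BoundaryDefectGaussianR`, specialised to `k = 2`, `L = (2,2)`, sink `j = 1`, the reference square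
`(-1,1)²` with the two marks `(∓1/3, -1)` on its bottom side (boundary parameters `1/12`, `1/6`), a conformal
map of the square onto the upper half-plane which is holomorphic across the open bottom side with increasing
real part there, the meshes `δ_n = 1/(12(n+1))`, the lattice squares `V_n = [-12(n+1), 12(n+1)]²` and the
bottom-row points `(∓4(n+1), -12(n+1))` (the canonical configuration of the reference square, injective and
admissible for EVERY `n` by `canonical_admissible`): the normalised rainbow ratio `δ_n^{-2/3} ‖Zins‖/‖Z‖`
converges to the crux's limit value, which is POSITIVE by the flat-mark geometry `s6_flatMarkGeometry`
(`w′ ≠ 0` at the marks, `w` injective on the marks).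

* `crux22_sink` — the sink rule `L 1 = Σ_{i ≠ 1} L i` for `L = (2,2)`;
* `crux22_exponent` — the Kac bookkeeping `Σ_i e_i (e_i - 1) / 6 = 2/3` for the labels `e = (2, -1)`;
* `crux22_mesh` — `δ_n > 0`, `δ_n → 0`, `1/δ_n = 12(n+1)`;
* `crux22_canonical` — the bottom-row points are the canonical configuration `(⌊x_i/δ_n⌋, -⌊1/δ_n⌋₊)`;
* `h19_crux22` — the registered stub H7.
-/

noncomputable section

open Filter Topology Set
open Literature.Probability.RandomPlanarGeometry Literature.Probability.LatticeModels
  Literature.Probability.LatticeModels.CollarLegModel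

namespace Summit.CriticalPhenomena.CardyFormulaZ2.Cruxes.BoundaryDefectGaussianR.RainbowMonomialsInExcursionKernels

/-! ### Arithmetic of the `(2;2)` family and of the meshes `1/(12(n+1))` -/

/-- The sink rule for the leg family `(2;2)`: `L 1 = Σ_{i ≠ 1} L i` for `L = (2, 2)`. [folklore] -/
theorem crux22_sink : (![2, 2] : Fin 2 → ℕ) 1 = ∑ i ∈ Finset.univ.erase 1, (![2, 2] : Fin 2 → ℕ) i := by
  decide

/-- The Kac bookkeeping of the `(2;2)` family: with the labels `e = (L 0, 1 - L 1) = (2, -1)`,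
`Σ_i e_i (e_i - 1) / 6 = 2/3` — the lattice normalisation `δ^{-2/3}`. [folklore] -/
theorem crux22_exponent :
    (∑ i : Fin 2, (if i = 1 then (1 - (((![2, 2] : Fin 2 → ℕ) 1 : ℕ) : ℝ)) else (((![2, 2] : Fin 2 → ℕ) i : ℕ) : ℝ)) *
      ((if i = 1 then (1 - (((![2, 2] : Fin 2 → ℕ) 1 : ℕ) : ℝ)) else (((![2, 2] : Fin 2 → ℕ) i : ℕ) : ℝ)) - 1) / 6) =
      2 / 3 := by
  rw [Fin.sum_univ_two, if_neg (show (0 : Fin 2) ≠ 1 by decide), if_pos rfl]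
  simp only [Matrix.cons_val_zero, Matrix.cons_val_one]
  norm_num

/-- The meshes `δ_n = 1/(12(n+1))` are positive, tend to `0`, and `1/δ_n = 12(n+1)`. [folklore] -/
theorem crux22_mesh {δ : ℕ → ℝ} (hδ : ∀ n, δ n = 1 / (12 * ((n : ℝ) + 1))) :
    (∀ n, 0 < δ n) ∧ Filter.Tendsto δ Filter.atTop (nhds 0) ∧ ∀ n, 1 / δ n = ((12 * (n + 1) : ℕ) : ℝ) := by
  refine ⟨fun n ↦ by rw [hδ n]; positivity, ?_, fun n ↦ by rw [hδ n, one_div_one_div]; push_cast; ring⟩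
  have h := tendsto_one_div_add_atTop_nhds_zero_nat.const_mul (1 / 12 : ℝ)
  rw [mul_zero] at h
  exact h.congr fun n ↦ by rw [hδ n, one_div_mul_one_div]

/-- At mesh `δ_n = 1/(12(n+1))`, `⌊1/δ_n⌋₊ = 12(n+1)` and the bottom-row points `(∓4(n+1), -12(n+1))` are the
canonical configuration `(⌊x_i/δ_n⌋, -⌊1/δ_n⌋₊)`, `x_i = 2(i+1)/3 - 1 = ∓1/3`, of the reference square with two
marks. [folklore] -/
theorem crux22_canonical {δ : ℕ → ℝ} (hδ : ∀ n, δ n = 1 / (12 * ((n : ℝ) + 1))) {p : ℕ → Fin 2 → ℤ × ℤ}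
    (hp0 : ∀ n, p n 0 = (-(4 * ((n : ℤ) + 1)), -(12 * ((n : ℤ) + 1))))
    (hp1 : ∀ n, p n 1 = (4 * ((n : ℤ) + 1), -(12 * ((n : ℤ) + 1)))) (n : ℕ) :
    ⌊1 / δ n⌋₊ = 12 * (n + 1) ∧
      ∀ i, p n i = (⌊(2 * ((i : ℝ) + 1) / (((2 : ℕ) : ℝ) + 1) - 1) / δ n⌋, -(⌊1 / δ n⌋₊ : ℤ)) := by
  obtain ⟨-, -, hinv⟩ := crux22_mesh hδ
  have hA : ⌊1 / δ n⌋₊ = 12 * (n + 1) := by rw [hinv n, Nat.floor_natCast]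
  have hx : ∀ x : ℝ, x / δ n = x * (12 * ((n : ℝ) + 1)) := fun x ↦ by
    rw [div_eq_mul_one_div, hinv n]; push_cast; ring
  refine ⟨hA, Fin.forall_fin_two.2 ⟨?_, ?_⟩⟩
  · rw [hp0 n, hA, hx, show (2 * ((((0 : Fin 2) : ℕ) : ℝ) + 1) / (((2 : ℕ) : ℝ) + 1) - 1) * (12 * ((n : ℝ) + 1)) =
        (((-(4 * ((n : ℤ) + 1))) : ℤ) : ℝ) by push_cast; simp only [Fin.val_zero, Nat.cast_zero]; ring,
      Int.floor_intCast]
    push_cast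
    ring_nf
  · rw [hp1 n, hA, hx, show (2 * ((((1 : Fin 2) : ℕ) : ℝ) + 1) / (((2 : ℕ) : ℝ) + 1) - 1) * (12 * ((n : ℝ) + 1)) =
        (((4 * ((n : ℤ) + 1)) : ℤ) : ℝ) by push_cast; simp only [Fin.val_one, Nat.cast_one]; ring,
      Int.floor_intCast]
    push_cast
    ring_nf

/-! ### Stub H7 — the `(2;2)` member of the crux along the lattice squares -/

/-- **Stub H7.** `BoundaryDefectGaussianR`, specialised to `k = 2`, `L = (2,2)`, sink `j = 1`, the reference square
`(-1,1)²` with the marks `(∓1/3, -1)` (parameters `1/12`, `1/6`), a conformal map as in Stub H1, the meshes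
`δ_n = 1/(12(n+1))`, the lattice squares `V_n` and the bottom-row points `(∓4(n+1), -12(n+1))` (admissible for every `n`,
`canonical_admissible`): the normalised rainbow ratio `δ_n^{-2/3} ‖Zins‖/‖Z‖` converges to a POSITIVE limit
(`C · |w(x)-w(y)|^{-2/3} |w′(x)|^{1/3} |w′(y)|^{1/3} > 0` by `s6_flatMarkGeometry`). [folklore] -/
theorem h19_crux22 : Summit.CriticalPhenomena.CardyFormulaZ2.Theses.CardyBoundaryCoulombGas.BoundaryDefectGaussianR →
    (∃ (w : ℂ → ℂ) (U : Set ℂ), IsOpen U ∧ Literature.Probability.RandomPlanarGeometry.symRect 1 1 ⊆ U ∧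
      (∀ x : ℝ, -1 < x → x < 1 → (⟨x, -1⟩ : ℂ) ∈ U) ∧ DifferentiableOn ℂ w U ∧
      Set.BijOn w (Literature.Probability.RandomPlanarGeometry.symRect 1 1) {z : ℂ | 0 < z.im} ∧
      StrictMonoOn (fun x : ℝ ↦ (w ⟨x, -1⟩).re) (Set.Ioo (-1) 1)) →
    ∀ (δ : ℕ → ℝ) (V : ℕ → Finset (ℤ × ℤ)) (p : ℕ → Fin 2 → ℤ × ℤ),
    (∀ n, δ n = 1 / (12 * ((n : ℝ) + 1))) →
    (∀ n, ∀ v : ℤ × ℤ, v ∈ V n ↔ ((v.1 : ℂ) * ((δ n : ℝ) : ℂ) + (v.2 : ℂ) * ((δ n : ℝ) : ℂ) * Complex.I) ∈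
      closure (Literature.Probability.RandomPlanarGeometry.symRect 1 1)) →
    (∀ n, p n 0 = (-(4 * ((n : ℤ) + 1)), -(12 * ((n : ℤ) + 1)))) →
    (∀ n, p n 1 = (4 * ((n : ℤ) + 1), -(12 * ((n : ℤ) + 1)))) →
    ∃ κ : ℝ, 0 < κ ∧ Filter.Tendsto (fun n ↦ (δ n) ^ (-(2 / 3 : ℝ)) *
      (‖Literature.Probability.LatticeModels.CollarLegModel.Zins (V n)
          (⟨(Finset.univ.erase 1).image (p n), fun v ↦ ∑ i ∈ (Finset.univ.erase 1).filter (fun i ↦ p n i = v),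
            (![2, 2] : Fin 2 → ℕ) i, p n 1⟩ : Literature.Probability.LatticeModels.CollarLegModel.LegInsertionData)‖ /
        ‖(Literature.Probability.LatticeModels.CollarLegModel.ofDomain (V n)).Z‖)) Filter.atTop (nhds κ) := by
  intro hBDG hmap δ V p hδ hV hp0 hp1
  obtain ⟨w, U, hU, hsub, hbot, hdiff, hbij, hmono⟩ := hmap
  obtain ⟨hδpos, hδ0, hinv⟩ := crux22_mesh hδ
  -- the reference square `(-1,1)²` with the two marks `(∓1/3, -1)` (parameters `1/12`, `1/6`)
  set D₀ : MarkedDomain 2 := ⟨rectDomain 1 1 one_pos one_pos, fun i ↦ ((i : ℝ) + 1) / (4 * (((2 : ℕ) : ℝ) + 1)),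
    square_mark_strictMono 2, square_mark_mem 2⟩ with hD₀
  obtain ⟨hrect, hflat, -⟩ := refSquare_geometry 2 1 D₀ hD₀
  have hbd : ∀ t, D₀.boundary t = polygonLoop (rectVerts 1 1) t := fun t ↦ rfl
  have hmark : ∀ i, D₀.mark i = ((i : ℝ) + 1) / (4 * (((2 : ℕ) : ℝ) + 1)) := fun i ↦ rfl
  have hpt : ∀ i, D₀.pt i = ⟨2 * ((i : ℝ) + 1) / (((2 : ℕ) : ℝ) + 1) - 1, -1⟩ := fun i ↦
    polygonLoop_square_mark 2 i
  have hi1 : ∀ i : Fin 2, (0 : ℝ) ≤ ((i : ℕ) : ℝ) ∧ ((i : ℕ) : ℝ) ≤ 1 := fun i ↦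
    ⟨Nat.cast_nonneg _, by exact_mod_cast i.is_le⟩
  -- the conformal map package in the crux's format
  have hsubU : D₀.carrier ⊆ U := hsub
  have hbijD : Set.BijOn w D₀.carrier {z : ℂ | 0 < z.im} := hbij
  have hptU : ∀ i, D₀.pt i ∈ U := by
    intro i
    obtain ⟨h0, h1⟩ := hi1 i
    rw [hpt i]
    exact hbot _ (by push_cast; linarith) (by push_cast; linarith)
  have hmonoT : ∀ i, ∃ ε : ℝ, 0 < ε ∧ StrictMonoOn (fun t : ℝ ↦ (w (D₀.boundary t)).re)
      (Set.Ioo (D₀.mark i - ε) (D₀.mark i + ε)) := by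
    intro i
    obtain ⟨h0, h1⟩ := hi1 i
    refine ⟨1 / 24, by norm_num, ?_⟩
    intro a ha b hb hab
    rw [hmark i] at ha hb
    obtain ⟨ha1, ha2⟩ := ha
    obtain ⟨hb1, hb2⟩ := hb
    push_cast at ha1 ha2 hb1 hb2
    have ha0 : 0 ≤ a := by linarith
    have ha4 : a ≤ 1 / 4 := by linarith
    have hb0 : 0 ≤ b := by linarith
    have hb4 : b ≤ 1 / 4 := by linarith
    show (w (D₀.boundary a)).re < (w (D₀.boundary b)).re
    rw [hbd a, hbd b, polygonLoop_square_bottom ha0 ha4, polygonLoop_square_bottom hb0 hb4]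
    exact hmono ⟨by linarith, by linarith⟩ ⟨by linarith, by linarith⟩ (by linarith)
  -- the lattice squares and the bottom-row points in the crux's format
  have hVbox : ∀ n, ∀ v : ℤ × ℤ, v ∈ V n ↔ (-(⌊1 / δ n⌋₊ : ℤ) ≤ v.1 ∧ v.1 ≤ ⌊1 / δ n⌋₊) ∧
      (-(⌊1 / δ n⌋₊ : ℤ) ≤ v.2 ∧ v.2 ≤ ⌊1 / δ n⌋₊) := fun n ↦ square_latticeBox (hδpos n) (hV n)
  have hpcanon : ∀ n i, p n i = (⌊(2 * ((i : ℝ) + 1) / (((2 : ℕ) : ℝ) + 1) - 1) / δ n⌋, -(⌊1 / δ n⌋₊ : ℤ)) :=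
    fun n ↦ (crux22_canonical hδ hp0 hp1 n).2
  have hsmall : ∀ n, ((∑ i, (![2, 2] : Fin 2 → ℕ) i : ℕ) : ℝ) + 2 ≤ 2 / (((2 : ℕ) : ℝ) + 1) / δ n := by
    intro n
    have hn : (0 : ℝ) ≤ n := Nat.cast_nonneg n
    rw [div_eq_mul_one_div _ (δ n), hinv n, Fin.sum_univ_two]
    simp only [Matrix.cons_val_zero, Matrix.cons_val_one]
    push_cast
    linarith
  have hcan := fun n ↦ canonical_admissible 2 ![2, 2] 1 ⟨0, by decide⟩
    (Fin.forall_fin_two.2 ⟨fun _ ↦ by norm_num, fun _ ↦ by norm_num⟩) (hδpos n) (hsmall n) (hVbox n) (hpcanon n)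
  have hconv : ∀ i, Filter.Tendsto (fun n ↦ ((p n i).1 : ℂ) * ((δ n : ℝ) : ℂ) + ((p n i).2 : ℂ) * ((δ n : ℝ) : ℂ) *
      Complex.I) Filter.atTop (nhds (D₀.pt i)) := fun i ↦ canonical_tendsto_pt 2 D₀ hD₀ hδpos hδ0 hpcanon i
  -- apply the crux and read off the exponent and the positivity of the limit
  obtain ⟨C, hC, hall⟩ := hBDG 2 ![2, 2] 1 crux22_sink
  have key := hall D₀ hrect hflat w U hU hsubU hptU hdiff hbijD hmonoT δ hδpos hδ0 V hV p
    (fun n ↦ (hcan n).1) hconv (fun n ↦ (hcan n).2)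
  rw [crux22_exponent] at key
  obtain ⟨-, hderiv, hwinj⟩ := s6_flatMarkGeometry 2 D₀ hflat w U hU hsubU hptU hdiff hbijD hmonoT
  refine ⟨_, ?_, key.congr fun n ↦ mul_div_assoc _ _ _⟩
  refine mul_pos (mul_pos hC (Finset.prod_pos fun i _ ↦ Finset.prod_pos fun i' hi' ↦ ?_))
    (Finset.prod_pos fun i _ ↦ ?_)
  · exact Real.rpow_pos_of_pos (norm_pos_iff.2 (sub_ne_zero.2 (hwinj i i' (Finset.mem_filter.1 hi').2.ne))) _
  · exact Real.rpow_pos_of_pos (norm_pos_iff.2 (hderiv i)) _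

end Summit.CriticalPhenomena.CardyFormulaZ2.Cruxes.BoundaryDefectGaussianR.RainbowMonomialsInExcursionKernels

end
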